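import Mathlib
import HarnessLib
import HarnessLib.Audit
import Summits.FinalStateConjecture.Statement
import Literature.Geometry.Lorentzian.CoordCurvature
import Literature.Geometry.Lorentzian.KerrSchild
import HarnessLib.Audit.Status.Attr

/-!
Route: TemporalBandLiouville

# Route TemporalBandLiouville — eternal non-radiating vacuum exteriors are band-limited in time,
band-limited ones are stationary (Titchmarsh inflation + time-analytic continuation), stationary
limits close the conjecture

It suffices to show X ∧ R. X (ETERNAL EXTERIOR LIOUVILLE, item EternalExteriorStationary): a vacuum
metric given by its components G in ONE global coordinate system (x⁰ = t, x⃗) on the eternal excised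
cylinder ℝ_t × {r(a,x⃗) > r₀} (`Kerr.region a r₀`, excision surface spacelike with inflow, slices
uniformly spacelike), in harmonic (wave) coordinates, two-sided uniformly bounded in every C^k, and
uniformly asymptotically flat at STATIONARY rates (‖G−η‖ ≤ C/ρ, ‖DG‖ ≤ C/ρ², ‖D²G‖ ≤ C/ρ³, uniformly
in t — this encodes "no radiation in or out, ever", gauge waves included) is t-independent. X is
split by the card's object, the TEMPORAL BAND: X ⇐ C1 (BandFromNonradiation: such G is band-limited
in t — every component t ↦ G(t,x⃗)vw is the restriction of an entire function of exponential type b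
bounded by C e^{b|Im z|}, i.e. compact temporal spectrum) → C2 (BandLimitedLiouville: band-limited +
the same hypotheses ⇒ stationary). R (StationaryLimitReduction): X → FinalStateConjecture — the
stationary-limit architecture (ω-limits of late exteriors in comoving harmonic gauge exist and
satisfy X's hypotheses; stationary ⇒ Kerr; capture; generic complete 𝓘⁺ and sub-extremality).
Realises card titchmarsh-band-inflation-kerr-schild-escape (K1 = C1; K2+K3 = C2; K4 = the
harmonic-gauge clause, supplied by R; P3 Bernstein bridge = the time-analytic engine of C2).
Lean: `∀ (a r₀ : ℝ) (G : Literature.Geometry.Lorentzian.E4 → Literature.Geometry.Lorentzian.E4 →L[ℝ]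
Literature.Geometry.Lorentzian.E4 →L[ℝ] ℝ), (0 < r₀ ∧
Literature.Geometry.Lorentzian.MetricCoord.IsMetricOn G (Literature.Geometry.Lorentzian.Kerr.region
a r₀ : Set Literature.Geometry.Lorentzian.E4) ∧ (∃ c₀ δ : ℝ, 0 < c₀ ∧ 0 < δ ∧ ∀ x ∈
Literature.Geometry.Lorentzian.Kerr.region a r₀, (Literature.Geometry.Lorentzian.E4.dx 0)
(Literature.Geometry.Lorentzian.MetricCoord.sharpAt G x (Literature.Geometry.Lorentzian.E4.dx 0)) ≤
-c₀ ∧ (Literature.Geometry.Lorentzian.Kerr.radius a x < r₀ + δ → (fderiv ℝ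
(Literature.Geometry.Lorentzian.Kerr.radius a) x)
(Literature.Geometry.Lorentzian.MetricCoord.sharpAt G x (fderiv ℝ
(Literature.Geometry.Lorentzian.Kerr.radius a) x)) ≤ -c₀ ∧ c₀ ≤
(Literature.Geometry.Lorentzian.E4.dx 0) (Literature.Geometry.Lorentzian.MetricCoord.sharpAt G x
(fderiv ℝ (Literature.Geometry.Lorentzian.Kerr.radius a) x)))) ∧ (∀ x ∈
Literature.Geometry.Lorentzian.Kerr.region a r₀, Literature.Geometry.Lorentzian.MetricCoord.ricAt G
x = 0) ∧ (∀ x ∈ Literature.Geometry.Lorentzian.Kerr.region a r₀, ∑ β : Fin 4,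
Literature.Geometry.Lorentzian.MetricCoord.chrAt G x
(Literature.Geometry.Lorentzian.MetricCoord.sharpAt G x (Literature.Geometry.Lorentzian.E4.dx β))
(Literature.Geometry.Lorentzian.E4.basisVector β) = 0) ∧ (∀ k : ℕ, ∃ C : ℝ, ∀ x ∈
Literature.Geometry.Lorentzian.Kerr.region a r₀, ‖iteratedFDeriv ℝ k G x‖ ≤ C ∧
‖Literature.Geometry.Lorentzian.MetricCoord.sharpAt G x‖ ≤ C) ∧ (∃ C : ℝ, ∀ x ∈
Literature.Geometry.Lorentzian.Kerr.region a r₀, ‖G x -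
Literature.Geometry.Lorentzian.Minkowski.bilin‖ ≤ C / Literature.Geometry.Lorentzian.E4.spatialNorm
x ∧ ‖iteratedFDeriv ℝ 1 G x‖ ≤ C / Literature.Geometry.Lorentzian.E4.spatialNorm x ^ 2 ∧
‖iteratedFDeriv ℝ 2 G x‖ ≤ C / Literature.Geometry.Lorentzian.E4.spatialNorm x ^ 3)) → ∀ x ∈
Literature.Geometry.Lorentzian.Kerr.region a r₀, ∀ s : ℝ, G (x + s •
Literature.Geometry.Lorentzian.E4.basisVector 0) = G x`

## Assembly
Pure logic (sorry-free in Sketch.lean: `targetOfCruxes_holds`, `assembly_holds`, `closes`): C1 gives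
the band for every G in the class, C2 turns band into stationarity, so X holds (TargetOfCruxes); R
:= StationaryLimitReduction maps X to the Statement. The deciding theorem is `closes (hX :
EternalExteriorStationary) … (hR : StationaryLimitReduction) … : FinalStateConjecture := hR hX` with
all seven items as hypotheses.

Rationale: WHY THIS LINE. Write h := ∂_t G. Because the harmonic-gauge reduced Einstein system is AUTONOMOUS
and quasilinear, h solves its linearisation about G EXACTLY — no perturbation theory; what is
missing for a Liouville theorem is (i) vanishing of h near infinity (Rellich zone: Papapetrou
doi:10.1002/andp.19574550709, Bičák–Scholtz–Tod doi:10.1088/0264-9381/27/5/055007, Alexakis–Schlue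
doi:10.4310/jdg/1513998029 Thm 1.1–1.3: periodic/non-radiating ⇒ stationary NEAR INFINITY only) and
(ii) unique continuation inward, which for merely smooth t-dependence dies at the first trapped null
geodesic (Alinhac–Baouendi; AS 2015 p. 4 "formidable challenge … trapped null geodesics"). The
card's object repairs (ii): a compact temporal band makes G and h ENTIRE in t
(Paley–Wiener–Bernstein), and for operators analytic in t the Tataru–Robbiano–Zuily–Hörmander
theorem (doi:10.1080/03605309508821117; doi:10.4171/jems/854 §1.2, case (E) transversal ellipticity)
continues across EVERY non-characteristic surface wherever ∂_t is timelike — through the photon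
region with no convexity at all — and inside the ergo-belt asks pseudoconvexity only against null
bicharacteristics annihilating ∂_t, i.e. ZERO-ENERGY null geodesics: exactly Ionescu–Klainerman's
T-conditional pseudo-convexity (doi:10.1007/s00222-008-0146-6, doi:10.1007/s00220-010-1072-1,
verified near Kerr). Where even that fails the card's signature-blind engine takes over:
Titchmarsh–Lions support inflation for the degree-8 polynomialised Einstein operator det(g)²Ric
(arXiv:1810.09047 Thm 2, 6; arXiv:2109.02187) forces the top temporal germ into the cancellation
variety 𝒱 = {det φ = 0} ∪ {imaginary-homothetic complex vacuum germs}, whose AF part is Kerr–Schild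
(doi:10.1063/1.522480, doi:10.1063/1.523851) — GR's affine sector, killed by real-frequency linear
rigidity (arXiv:1302.6902). Imported areas: harmonic analysis of entire functions (Paley–Wiener,
Bernstein, Titchmarsh), Carleman/partial-analyticity unique continuation (control theory),
Komech–Comech attractor theory for U(1)-Hamiltonian PDEs with the dictionary mass gap ↦ C1, one
frequency ↦ frequency 0 by reality. New relative to every filed FSC card/route: band-limitation as
the intermediate target, and the identification "belt residual of a time-analytic Liouville theorem
= zero-energy null convexity = IK's condition". No route exists on this summit; negatives index
empty.

RANKED CRUXES. #0 EternalExteriorStationary (target) — X. For all a, r₀ > 0 and G : E4 → (E4 →L E4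
→L ℝ) with: IsMetricOn G on Kerr.region a r₀ (smooth, symmetric, invertible); slices {t = const}
uniformly spacelike (g⁻¹(dt,dt) ≤ −c₀); excision collar {r < r₀+δ} with dr timelike and inflow
(g⁻¹(dr,dr) ≤ −c₀, g⁻¹(dt,dr) ≥ c₀); Ric(G) = 0; harmonic coordinates g^{αβ}Γ^μ_{αβ} = 0; every C^k
norm of G and ‖G⁻¹‖ bounded on the whole cylinder; ‖G−η‖ ≤ C/ρ, ‖DG‖ ≤ C/ρ², ‖D²G‖ ≤ C/ρ³ (ρ = |x⃗|)
— THEN G(x + s e₀) = G(x) for all s (∂_t is Killing). Black-hole case of "eternal two-sided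
non-radiating vacuum exteriors are stationary"; the horizonless sibling (no excision) is left to the
no-geon cards. (why it might fail: X fails iff a vacuum breather exists: eternal, bounded,
non-radiating yet non-stationary — e.g. hair guided by trapped zero-energy null geodesics in the
ergo-belt of a non-Kerr stationary hole, or interior hair flat to infinite order at 𝓗⁺; none is
known, none is excluded.) [doi:10.4310/jdg/1513998029, doi:10.1088/0264-9381/27/5/055007,
doi:10.1002/andp.19574550709, doi:10.1007/s00222-008-0146-6, arXiv:1810.09047]
#2 BandLimitedLiouville (crux) — FINITE-BAND LIOUVILLE (card K2+K3, the refuter's "no finite-band AF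
vacuum breather"): under the hypotheses of X, if in addition G is band-limited in t (∃ b, C: every t
↦ G(t,x⃗)(v,w) extends to an entire F with |F(z)| ≤ C‖v‖‖w‖e^{b|Im z|}), then G is t-independent.
Engines: h = ∂_tG solves the linearised reduced vacuum system exactly; Rellich per frequency in the
far zone (StaticZoneLiouville); Tataru–RZ–Hörmander time-analytic continuation wherever ∂_t is
timelike; in the ergo-belt either T-conditional (zero-energy) pseudoconvexity of the limit or the
Titchmarsh sieve: top germ ∈ 𝒱, gauge germs removed by the harmonic clause, Kerr–Schild germs linear
and killed at real frequency. [difficulty: open-problem] (why it might fail: Neither engine closes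
the ergo-belt: analytic-in-t continuation needs convexity w.r.t. zero-energy null geodesics (IK
T-conditional pseudoconvexity, known only near Kerr); the Titchmarsh sieve leaves Kerr–Schild and
imaginary-homothetic top germs (kit j001060 B) to an open real-frequency problem.)
[arXiv:1810.09047, arXiv:2109.02187, doi:10.1080/03605309508821117, doi:10.4171/jems/854,
doi:10.1007/s00220-010-1072-1, doi:10.1063/1.523851, arXiv:1302.6902, doi:10.4310/jdg/1513998029]
#3 BandFromNonradiation (crux) — BAND FROM NON-RADIATION (card K1, Comech's "hard task" with mass
gap ↦ leaky trapping): under the hypotheses of X alone, G is band-limited in t (same Bernstein-class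
conclusion, b and C uniform on the cylinder). Mechanism proposed by the card: high temporal
frequencies of an eternal solution ride null geodesics of G; backwards in time they come from 𝓘⁻
(excluded: no incoming radiation), from the horizon side (excluded: backward blue-shift contradicts
two-sided C^k bounds when κ > 0) or sit eternally on the trapped set (excluded when trapping is
unstable) — so none are present. [difficulty: open-problem] (why it might fail: Semiclassical
propagation gives O(λ^-∞) high-frequency decay (smoothness or Gevrey class in t), not a compact
spectrum; exact band-limitation may be as hard as X itself, and the red-shift leg is absent for
extremal limits (Aretakis hair).) [arXiv:1305.1723, arXiv:1402.7034, arXiv:0811.0354,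
arXiv:1404.7036, doi:10.1142/12602, arXiv:1810.09047]
#4 StationaryLimitReduction (crux) — THE STATIONARY-LIMIT ARCHITECTURE: X → FinalStateConjecture.
Informally: (i) for a Christodoulou-generic admissible datum the MGHD exists, has complete 𝓘⁺, and
its exterior admits late-time comoving harmonic charts with two-sided C^k bounds, so that every
ω-limit (time-translation limit) around each final concentration region is a G satisfying the
hypotheses of X (excised inside the apparent horizon, stationary-rate fall-off because Bondi mass
and horizon area are constant on ω-limits), or is empty (dispersal); (ii) by X the limit is
stationary, hence (smooth black-hole uniqueness in this class) a sub-extremal Kerr exterior,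
generically; (iii) uniqueness of the limit plus Kerr capture (nonlinear stability) upgrades
subsequential convergence to the C² `FinalStateDecomposition` with `HasExhaustiveCharts`, receding
holes pairwise separating. Shared with the LaSalle/dissipation-budget/Burnett cards; filed here so
that the route decides the Statement. [deps: EternalExteriorStationary] [difficulty: open-problem]
(why it might fail: Contains weak cosmic censorship, C^k-compactness of late exteriors in comoving
harmonic gauge, smooth black-hole uniqueness (stationary ⇒ Kerr, open beyond near-Kerr or analytic)
and sub-extremal Kerr capture (nonlinear stability known only for |a| ≪ M); any of them may fail or
stay out of reach.) [arXiv:1710.01722, arXiv:2104.11857, arXiv:2205.14808, arXiv:2104.08222,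
doi:10.1007/s00220-010-1072-1, arXiv:0805.3880]
#9 TargetOfCruxes (support) — BandFromNonradiation → BandLimitedLiouville →
EternalExteriorStationary (pure logic; the hypothesis bundles are syntactically identical; proved in
Sketch.lean `targetOfCruxes_holds`). [difficulty: provable-now] [arXiv:1810.09047]
#9 StaticZoneLiouville (support) — THE KNOWN-TECHNOLOGY HALF OF C2 (Rellich zone + time-analytic
continuation, belt excluded): under the hypotheses of X, if G is merely time-ANALYTIC IN A UNIFORM
STRIP (each component extends holomorphically to {|Im z| < σ}, bounded by C‖v‖‖w‖) and on the far
zone {ρ ≥ r₁} the field ∂_t is uniformly timelike (G(e₀,e₀) ≤ −c₁) and the coordinate spheres are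
uniformly non-characteristic (g⁻¹(dρ,dρ) ≥ c₁), then G is t-independent on {ρ > r₁}. Proof plan: h =
∂_tG solves the linearised reduced system; Fourier in t + Rellich–Vekua for the weakly coupled
Helmholtz system with Coulomb tails kills h near infinity; Tataru–Robbiano–Zuily–Hörmander
(transversally elliptic case (E)) sweeps the spheres inward, uniformly in t by the C^k bounds.
Serves eternal-papapetrou-temporal-spectrum as well (its conditional K3(ii)). [difficulty: L]
[doi:10.1080/03605309508821117, doi:10.4171/jems/854, doi:10.4310/jdg/1513998029,
doi:10.1088/0264-9381/27/5/055007]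

TWO-LAYER PLAN. C2 ⇐ FarAndStaticZone (= StaticZoneLiouville upgraded to the band case) → BeltSieve
(at every belt point with b(x) > 0 the top temporal germ of a band-limited vacuum G lies in 𝒱;
Bohr/trigonometric-polynomial spectra first, where the full harmonic hierarchy E_8,…,E_0 is
rigorous) → KerrSchildTopsDie (a Kerr–Schild top harmonic solves linearised vacuum at real frequency
b with zero radiation field and is zero; near-Kerr belts by AIK T-conditional Carleman, general
belts open) → C2. Alternative child of C2 if the sieve stalls: ZeroEnergyConvexity (the limit's
ergo-belt carries no trapped null geodesic orthogonal to ∂_t ⇒ Tataru continuation reaches the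
horizon). C1 ⇐ HighFrequencyVacuity (semiclassical: eternal + no incoming radiation + red-shift +
unstable trapping ⇒ h-uniform smallness of the λ-band content, all λ ≥ λ₀) → SpectrumEdge (autonomy
+ Titchmarsh inflation turn "super-polynomially small high-frequency tail" into "compact spectrum")
→ C1. R ⇐ OmegaLimitsExist → StationaryIsKerr → CaptureAndCharts (k = 3), only after X moves.

KILL CRITERIA. An explicit eternal, bounded, non-radiating, NON-stationary vacuum black-hole
exterior in harmonic coordinates (a vacuum breather; e.g. built on a non-Kerr stationary hole with a
zero-energy photon torus in its ergoregion) refutes EternalExteriorStationary and with it C1 or C2: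
close `refuted:EternalExteriorStationary` and hand the witness to the negatives index (it would also
bound every LaSalle-type route). A band-limited (even trigonometric-polynomial) AF vacuum breather
refutes BandLimitedLiouville alone: close `refuted:BandLimitedLiouville` (the card's engine is
dead). A proof that eternal non-radiating limits are time-analytic in a strip but NOT band-limited
kills C1 only: pivot by `--restate BandFromNonradiation` to the strip conclusion and C2 to
StaticZone + ZeroEnergyConvexity (then merge with an eternal-papapetrou route if one exists). Smooth
black-hole uniqueness + any eternal Liouville theorem proved elsewhere moots C1/C2: supersede.
StationaryLimitReduction can only die with the conjecture itself.

NOT DECOMPOSED YET. The belt (BeltSieve / KerrSchildTopsDie / ZeroEnergyConvexity), the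
Bohr-spectrum special case of C2, the near-Kerr perturbative case of C2 (needs harmonic
horizon-penetrating Kerr components, Cook–Scheel doi:10.1103/PhysRevD.56.4775, not yet in the
prelude), the horizonless sibling of X (no excision; owned by the no-geon cards), every piece of R
(ω-limit compactness, rigidity, capture, genericity of complete 𝓘⁺ and of |a| < M), and the
Literature facts the provers will want as hypotheses (Titchmarsh–Lions support theorem,
Tataru–Robbiano–Zuily–Hörmander theorem, Rellich–Vekua lemma) — all layer-2 or cite requests, later.

CHEAPEST FALSIFIER. (1) Literature/CAS: is there an exact vacuum solution whose harmonic-coordinate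
components are trigonometric polynomials in t and which is asymptotically flat and non-stationary?
Known periodic vacuum solutions — Einstein–Rosen/Bondi standing waves (doi:10.1098/rspa.2003.1176),
pp-wave breathers η + cos(νu)(x²−y²)du² (kit j001060 C of the card) — are cylindrical/plane, not AF,
and e^{2ψ} with ψ = J₀(ωρ)cos ωt is not even of exponential type: consistent, not a kill. (2) CAS,
one afternoon: the plane-symmetric single-harmonic hierarchy E_8 = … = E_0 for G = Σ_{|k|≤K}
ĝ_k(z)e^{ikωt} in harmonic gauge — any non-flat, non-pp-wave solution exposes a bookkeeping error in
C2's sieve. (3) Non-vacuity check of X's class: compute Kerr in Cook–Scheel horizon-penetrating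
harmonic coordinates and verify the seven hypothesis clauses (excision collar between r₋ and r₊,
fall-off constants) symbolically; failure would mean the typed class misses Kerr and X must be
restated. Not run here (hub is compute-free for planners' CAS; card's kit j001060 A–D stand).

NUMBERS. Ergoregion non-empty iff a ≠ 0 (Literature.Barriers.FinalStateConjecture.KerrSuperradiance,
proved); no constant combination of ∂_t*, ∂_φ* is timelike on the whole Kerr exterior for a ≠ 0
(KerrNoTimelikeKillingCombination, proved) — so the transversally-elliptic (free) regime of
time-analytic continuation never covers a rotating belt. Real-axis mode stability: |a| < M
(arXiv:1302.6902), |a| = M (arXiv:1910.02854). Nonlinear Kerr capture: |a|/M ≪ 1 (arXiv:2104.11857,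
arXiv:2205.14808); linear stability |a| < M (arXiv:2007.07211, arXiv:2302.08916). P = det(g)²Ric is
homogeneous of degree 8 in the 2-jet, so the band (7b, 8b] of P(G) is fed by P(h_top) alone (card,
kit j001060 D). Items at open: 7 (3 cruxes, 1 target, 1 assembly, 2 support).

DEFINITION REQUESTS. None needed for typing: everything is stated over
Literature.Geometry.Lorentzian.MetricCoord (IsMetricOn, ricAt, chrAt, sharpAt),
Kerr.region/Kerr.radius, Minkowski.bilin, E4.dx/basisVector/spatialNorm and Mathlib's Differentiable
ℂ / iteratedFDeriv. Wanted later as cite facts (kind cite, family gr): Titchmarsh–Lions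
convolution-support theorem (Hörmander ALPDO I Thm 4.3.3); Tataru–Robbiano–Zuily–Hörmander unique
continuation for operators analytic in part of the variables, transversally elliptic case
(doi:10.1080/03605309508821117, doi:10.4171/jems/854 Def 1.5 ff.); Rellich–Vekua uniqueness for
Helmholtz systems with Coulomb-type tails. A convenience definition `IsEternalHarmonicVacuumExterior
a r₀ G` (the 7-clause hypothesis bundle, verbatim the antecedent of EternalExteriorStationary) under
Summits/FinalStateConjecture/FinalStateConjecture/Theorems would shorten every item; to be filed in
tenure if grounders agree.

Novelty: Searches (2026-08-15; searchd local index down (rc 75 / connection reset) all session, external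
sources up): `lit frontier FinalStateConjecture --since 2020` (30 rows: trapped-surface formation,
Kerr(-dS) stability, smooth-null-infinity V, multi-black-hole data — nothing on eternal/periodic
rigidity); `lit bridges FinalStateConjecture --cross any` (30 rows, surveys); `lit search --source
crossref "unique continuation partial analyticity wave equation Tataru"` (6: Tataru
1995/1996/1999/2004, Koch–Tataru); `--source arxiv` same (2: arXiv:1506.04254 Laurent–Léautaud,
arXiv:1205.2459); `--source crossref "asymptotically flat solutions of Einstein's equations periodic
in time"` (BST I doi:10.1088/0264-9381/27/5/055007, II doi:10.1088/0264-9381/27/17/175011);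
`--source crossref "Papapetrou periodische nichtsinguläre Lösungen"` (doi:10.1002/andp.19574550709,
doi:10.1002/andp.19584570303); `--source crossref "uniqueness of smooth stationary black holes in
vacuum"` (doi:10.1007/s00222-008-0146-6, doi:10.1007/s00220-010-1072-1,
doi:10.1215/00127094-2819517); `--source zbmath "band-limited in time solutions Einstein equations
stationary"` (0); `--source crossref "entire functions of exponential type in time nonlinear wave
equation Liouville theorem stationary"` (5, none relevant); `lit galaxy search "time-periodic
vacuum" --star all` (pdf star: Komech–Komech math/0609013, Ulanovskii on Titchmarsh extensions;
nothing on GR); `lit read arxiv:1504.04592` pp. 1–8 (Thm 1.1, Def 1.1, the rema  [refs: 10.1088/0264-9381/27/5/055007, 10.1088/0264-9381/27/17/175011, 10.1002/andp.19574550709, 10.1002/andp.19584570303, 10.1007/s00222-008-0146-6, 10.1007/s00220-010-1072-1, 10.1215/00127094-2819517, 10.4310/jdg/1513998029, 10.1080/03605309508821117, 1506.04254, 1205.2459, 1504.04592, 1810.09047, 2109.02187, doi:10.1088/0264-9381/27/5/055007, doi:10.1088/0264-9381/27/17/175011, doi:10.1002/andp.1957455]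

Barriers (technique_class: temporal-band, titchmarsh-convolution, time-analytic-UC): - technique_class: temporal-band, titchmarsh-convolution, time-analytic-UC
- Literature.Barriers.FinalStateConjecture.IonescuKlainermanNonExtension: evaded in kind — nothing
is continued across the (characteristic) horizon or produced from local horizon data; continuation
runs inward from the Rellich zone with analyticity in t EARNED from the band (IK's counterexamples
are smooth, stationary and local), and the conceded residual is global: zero-energy null convexity
of the whole belt, or the Titchmarsh sieve which continues across nothing.
- Literature.Barriers.FinalStateConjecture.KerrSuperradiance: this is exactly where the free
(transversally elliptic) regime of time-analytic continuation stops — ∂_t spacelike in the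
ergoregion; the line does not use ∂_t-energy positivity and declares the belt as the crux of C2
(KerrNoTimelikeKillingCombination says no constant Killing combination rescues a rotating belt
globally).
- Literature.Barriers.FinalStateConjecture.SbierskiTrappingObstruction: consistent — no integrated
decay estimate is claimed; trapping enters C1 only qualitatively (unstable trapping cannot hold
eternal non-radiating high-frequency content) and C2 not at all outside the belt (analytic
continuation needs no convexity where ∂_t is timelike).
- Literature.Barriers.FinalStateConjecture.PriceLawTail: respected — no decay RATE anywhere; the
route is qualitative (eternal objects, exact non-radiation), rates live inside R with the stability
theorems it imports.
- Litera

Novelty grade: new-combination — ROUTE-REVIEW refuter-rreview-0815T15-9-0 (grade from the route's documented searches + this review; details in item notes 10170–10176 and seat REVIEW.md). NEW-COMBINATION: (non-radiating⇒stationary near infinity: Papapetrou/BST/Alexakis–Schlue) + (Tataru–RZ–Hörmander partial-analytic UC) + (Paley–Wi (refuter refuter-rreview-0815T15-9-0, 2026-08-15T15:59:38Z; prior: doi:10.1002/andp.19574550709, doi:10.1088/0264-9381/27/5/055007, doi:10.4310/jdg/1513998029, doi:10.1080/03605309508821117, doi:10.4171/jems/854, arXiv:1810.09047, arXiv:1312.1989,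 arXiv:1412.1537, ShlapentokhRothman2014KleinGordon, doi:10.1103/PhysRevD.56.4775)

History (route lifecycle, newest last):
- 2026-08-16T04:03:30Z · AUTO-CRUX (backfill): EternalExteriorStationary — hypotheses of the deciding theorem that nothing in the route derives are cruxes (operator:999:1085951)
- 2026-08-23T09:31:37Z · DORMANT — reconciler: no traction for 6 d (last activity item-evidence-added at 2026-08-17T07:58:14Z); parked, not closed — `ledger route dormant route-FinalStateConjectu (operator:999:1962964)
- 2026-08-31T00:00:49Z · REACTIVATED (open) — reconciler: reactivated — activity statement-checked at 2026-08-30T22:56:03Z after parking at 2026-08-23T09:31:37Z (operator:999:3267586)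

sub-problem: FinalStateConjecture · status: open · opened planner-plancard-FinalStateConjecture-FinalSt-3fc921ed-0 2026-08-15T15:16:26Z · rev 3 · ledger route-FinalStateConjecture-TemporalBandLiouville
GENERATED by the gate from the ledger (D-0016/17). Provers cite these decls: `theorem foo : Summit.FinalStateConjecture.FinalStateConjecture.Theses.TemporalBandLiouville.<Decl> := …` in Summits/FinalStateConjecture/FinalStateConjecture/Theorems/<Name>.lean.
-/

namespace Summit.FinalStateConjecture.FinalStateConjecture.Theses.TemporalBandLiouville

open scoped BigOperators Topology Manifold Classical MeasureTheory ProbabilityTheory Matrix InnerProductSpace ComplexConjugate ContinuousMap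
open Filter Set Function TopologicalSpace MeasureTheory

attribute [summit_statement] _root_.FinalStateConjecture

/-- item stmt-FinalStateConjecture-10170 · crux (kind.auto-crux: conjecture-grade) · rank 0 · open · by planner
why it might fail: False iff a vacuum breather exists: an eternal, C^k-bounded, two-sided non-radiating, NON-stationary harmonic-gauge exterior (hair on trapped zero-energy null rays of a non-Kerr ergo-belt, or flat to all orders at 𝓗⁺); none is excluded; periodic rigidity is known only near infinity (AS 2015).
sources: arXiv:1504.04592, doi:10.4310/jdg/1513998029, doi:10.1088/0264-9381/27/5/055007, doi:10.1002/andp.19574550709, doi:10.1007/s00222-008-0146-6, arXiv:1810.09047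
[target] X. For all a, r₀ > 0 and G : E4 → (E4 →L E4 →L ℝ) with: IsMetricOn G on Kerr.region a r₀
(smooth, symmetric, invertible); slices {t = const} uniformly spacelike (g⁻¹(dt,dt) ≤ −c₀); excision
collar {r < r₀+δ} with dr timelike and inflow (g⁻¹(dr,dr) ≤ −c₀, g⁻¹(dt,dr) ≥ c₀); Ric(G) = 0;
harmonic coordinates g^{αβ}Γ^μ_{αβ} = 0; every C^k norm of G and ‖G⁻¹‖ bounded on the whole
cylinder; ‖G−η‖ ≤ C/ρ, ‖DG‖ ≤ C/ρ², ‖D²G‖ ≤ C/ρ³ (ρ = |x⃗|) — THEN G(x + s e₀) = G(x) for all s (∂_t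
is Killing). Black-hole case of "eternal two-sided non-radiating vacuum exteriors are stationary";
the horizonless sibling (no excision) is left to the no-geon cards. -/
@[route_item "route-FinalStateConjecture-TemporalBandLiouville", crux]
def EternalExteriorStationary : Prop :=
  ∀ (a r₀ : ℝ) (G : Literature.Geometry.Lorentzian.E4 → Literature.Geometry.Lorentzian.E4 →L[ℝ] Literature.Geometry.Lorentzian.E4 →L[ℝ] ℝ), (0 < r₀ ∧ Literature.Geometry.Lorentzian.MetricCoord.IsMetricOn G (Literature.Geometry.Lorentzian.Kerr.region a r₀ : Set Literature.Geometry.Lorentzian.E4) ∧ (∃ c₀ δ : ℝ, 0 < c₀ ∧ 0 < δ ∧ ∀ x ∈ Literature.Geometry.Lorentzian.Kerr.region a r₀, (Literature.Geometry.Lorentzian.E4.dx 0) (Literature.Geometry.Lorentzian.MetricCoord.sharpAt G x (Literature.Geometry.Lorentzian.E4.dx 0)) ≤ -c₀ ∧ (Literature.Geometry.Lorentzian.Kerr.radius a x < r₀ + δ → (fderiv ℝ (Literature.Geometry.Lorentzian.Kerr.radius a) x) (Literature.Geometry.Lorentzian.MetricCoord.sharpAt G x (fderiv ℝ (Literature.Geometry.Lorentzian.Kerr.radius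 a) x)) ≤ -c₀ ∧ c₀ ≤ (Literature.Geometry.Lorentzian.E4.dx 0) (Literature.Geometry.Lorentzian.MetricCoord.sharpAt G x (fderiv ℝ (Literature.Geometry.Lorentzian.Kerr.radius a) x)))) ∧ (∀ x ∈ Literature.Geometry.Lorentzian.Kerr.region a r₀, Literature.Geometry.Lorentzian.MetricCoord.ricAt G x = 0) ∧ (∀ x ∈ Literature.Geometry.Lorentzian.Kerr.region a r₀, ∑ β : Fin 4, Literature.Geometry.Lorentzian.MetricCoord.chrAt G x (Literature.Geometry.Lorentzian.MetricCoord.sharpAt G x (Literature.Geometry.Lorentzian.E4.dx β)) (Literature.Geometry.Lorentzian.E4.basisVector β) = 0) ∧ (∀ k : ℕ, ∃ C : ℝ, ∀ x ∈ Literature.Geometry.Lorentzian.Kerr.region a r₀, ‖iteratedFDeriv ℝ k G x‖ ≤ C ∧ ‖Literature.Geometry.Lorentzian.MetricCoord.sharpAt G x‖ ≤ C) ∧ (∃ C : ℝ, ∀ x ∈ Literature.Geometry.Lorentzian.Kerr.region a r₀, ‖G x - Literature.Geometry.Lorentzian.Minkowski.bilin‖ ≤ C / Literature.Geometry.Lorentzian.E4.spatialNorm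 x ∧ ‖iteratedFDeriv ℝ 1 G x‖ ≤ C / Literature.Geometry.Lorentzian.E4.spatialNorm x ^ 2 ∧ ‖iteratedFDeriv ℝ 2 G x‖ ≤ C / Literature.Geometry.Lorentzian.E4.spatialNorm x ^ 3)) → ∀ x ∈ Literature.Geometry.Lorentzian.Kerr.region a r₀, ∀ s : ℝ, G (x + s • Literature.Geometry.Lorentzian.E4.basisVector 0) = G x

/-- item stmt-FinalStateConjecture-10171 · crux · rank 2 · open · by planner
why it might fail: Open even for t-periodic vacuum: AS/BST reach stationarity only NEAR INFINITY, the interior blocked by trapped null geodesics (arXiv:1504.04592 p.4); t-analytic UC through the ergo-belt needs IK T-pseudoconvexity, verified only near Kerr (AIK 2010); the Titchmarsh sieve leaves Kerr–Schild germs.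
sources: arXiv:1504.04592, doi:10.1088/0264-9381/27/5/055007, doi:10.1007/s00220-010-1072-1, doi:10.1007/s00222-008-0146-6, arXiv:1810.09047, arXiv:2109.02187
[crux] FINITE-BAND LIOUVILLE (card K2+K3, the refuter's "no finite-band AF vacuum breather"): under
the hypotheses of X, if in addition G is band-limited in t (∃ b, C: every t ↦ G(t,x⃗)(v,w) extends
to an entire F with |F(z)| ≤ C‖v‖‖w‖e^{b|Im z|}), then G is t-independent. Engines: h = ∂_tG solves
the linearised reduced vacuum system exactly; Rellich per frequency in the far zone
(StaticZoneLiouville); Tataru–RZ–Hörmander time-analytic continuation wherever ∂_t is timelike; in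
the ergo-belt either T-conditional (zero-energy) pseudoconvexity of the limit or the Titchmarsh
sieve: top germ ∈ 𝒱, gauge germs removed by the harmonic clause, Kerr–Schild germs linear and killed
at real frequency. [difficulty: open-problem] -/
@[route_item "route-FinalStateConjecture-TemporalBandLiouville", crux]
def BandLimitedLiouville : Prop :=
  ∀ (a r₀ : ℝ) (G : Literature.Geometry.Lorentzian.E4 → Literature.Geometry.Lorentzian.E4 →L[ℝ] Literature.Geometry.Lorentzian.E4 →L[ℝ] ℝ), (0 < r₀ ∧ Literature.Geometry.Lorentzian.MetricCoord.IsMetricOn G (Literature.Geometry.Lorentzian.Kerr.region a r₀ : Set Literature.Geometry.Lorentzian.E4) ∧ (∃ c₀ δ : ℝ, 0 < c₀ ∧ 0 < δ ∧ ∀ x ∈ Literature.Geometry.Lorentzian.Kerr.region a r₀, (Literature.Geometry.Lorentzian.E4.dx 0) (Literature.Geometry.Lorentzian.MetricCoord.sharpAt G x (Literature.Geometry.Lorentzian.E4.dx 0)) ≤ -c₀ ∧ (Literature.Geometry.Lorentzian.Kerr.radius a x < r₀ + δ → (fderiv ℝ (Literature.Geometry.Lorentzian.Kerr.radius a) x)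 (Literature.Geometry.Lorentzian.MetricCoord.sharpAt G x (fderiv ℝ (Literature.Geometry.Lorentzian.Kerr.radius a) x)) ≤ -c₀ ∧ c₀ ≤ (Literature.Geometry.Lorentzian.E4.dx 0) (Literature.Geometry.Lorentzian.MetricCoord.sharpAt G x (fderiv ℝ (Literature.Geometry.Lorentzian.Kerr.radius a) x)))) ∧ (∀ x ∈ Literature.Geometry.Lorentzian.Kerr.region a r₀, Literature.Geometry.Lorentzian.MetricCoord.ricAt G x = 0) ∧ (∀ x ∈ Literature.Geometry.Lorentzian.Kerr.region a r₀, ∑ β : Fin 4, Literature.Geometry.Lorentzian.MetricCoord.chrAt G x (Literature.Geometry.Lorentzian.MetricCoord.sharpAt G x (Literature.Geometry.Lorentzian.E4.dx β)) (Literature.Geometry.Lorentzian.E4.basisVector β) = 0) ∧ (∀ k : ℕ, ∃ C : ℝ, ∀ x ∈ Literature.Geometry.Lorentzian.Kerr.region a r₀, ‖iteratedFDeriv ℝ k G x‖ ≤ C ∧ ‖Literature.Geometry.Lorentzian.MetricCoord.sharpAt G x‖ ≤ C) ∧ (∃ C : ℝ, ∀ x ∈ Literature.Geometry.Lorentzian.Kerr.region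 a r₀, ‖G x - Literature.Geometry.Lorentzian.Minkowski.bilin‖ ≤ C / Literature.Geometry.Lorentzian.E4.spatialNorm x ∧ ‖iteratedFDeriv ℝ 1 G x‖ ≤ C / Literature.Geometry.Lorentzian.E4.spatialNorm x ^ 2 ∧ ‖iteratedFDeriv ℝ 2 G x‖ ≤ C / Literature.Geometry.Lorentzian.E4.spatialNorm x ^ 3)) → (∃ b C : ℝ, ∀ x ∈ Literature.Geometry.Lorentzian.Kerr.region a r₀, ∀ v w : Literature.Geometry.Lorentzian.E4, ∃ F : ℂ → ℂ, Differentiable ℂ F ∧ (∀ z : ℂ, ‖F z‖ ≤ C * ‖v‖ * ‖w‖ * Real.exp (b * |z.im|)) ∧ ∀ s : ℝ, F (s : ℂ) = ((G (x + s • Literature.Geometry.Lorentzian.E4.basisVector 0) v w : ℝ) : ℂ)) → ∀ x ∈ Literature.Geometry.Lorentzian.Kerr.region a r₀, ∀ s : ℝ, G (x + s • Literature.Geometry.Lorentzian.E4.basisVector 0) = G x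

/-- item stmt-FinalStateConjecture-10172 · crux · rank 3 · open · by planner
why it might fail: A breather of a nonlinear system generically carries ALL harmonics, so C1 most likely fails whenever X does; nothing known yields a COMPACT time spectrum: semiclassics give O(λ^-∞) tails only, stable trapping in a non-Kerr limit carries quasimodes (arXiv:1404.7036), the backward red-shift needs κ>0.
sources: arXiv:1404.7036, arXiv:1305.1723, arXiv:1402.7034, arXiv:0811.0354, doi:10.1142/12602, arXiv:1810.09047
[crux] BAND FROM NON-RADIATION (card K1, Comech's "hard task" with mass gap ↦ leaky trapping): under
the hypotheses of X alone, G is band-limited in t (same Bernstein-class conclusion, b and C uniform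
on the cylinder). Mechanism proposed by the card: high temporal frequencies of an eternal solution
ride null geodesics of G; backwards in time they come from 𝓘⁻ (excluded: no incoming radiation),
from the horizon side (excluded: backward blue-shift contradicts two-sided C^k bounds when κ > 0) or
sit eternally on the trapped set (excluded when trapping is unstable) — so none are present.
[difficulty: open-problem] -/
@[route_item "route-FinalStateConjecture-TemporalBandLiouville", crux]
def BandFromNonradiation : Prop :=
  ∀ (a r₀ : ℝ) (G : Literature.Geometry.Lorentzian.E4 → Literature.Geometry.Lorentzian.E4 →L[ℝ] Literature.Geometry.Lorentzian.E4 →L[ℝ] ℝ), (0 < r₀ ∧ Literature.Geometry.Lorentzian.MetricCoord.IsMetricOn G (Literature.Geometry.Lorentzian.Kerr.region a r₀ : Set Literature.Geometry.Lorentzian.E4) ∧ (∃ c₀ δ : ℝ, 0 < c₀ ∧ 0 < δ ∧ ∀ x ∈ Literature.Geometry.Lorentzian.Kerr.region a r₀, (Literature.Geometry.Lorentzian.E4.dx 0) (Literature.Geometry.Lorentzian.MetricCoord.sharpAt G x (Literature.Geometry.Lorentzian.E4.dx 0)) ≤ -c₀ ∧ (Literature.Geometry.Lorentzian.Kerr.radius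 a x < r₀ + δ → (fderiv ℝ (Literature.Geometry.Lorentzian.Kerr.radius a) x) (Literature.Geometry.Lorentzian.MetricCoord.sharpAt G x (fderiv ℝ (Literature.Geometry.Lorentzian.Kerr.radius a) x)) ≤ -c₀ ∧ c₀ ≤ (Literature.Geometry.Lorentzian.E4.dx 0) (Literature.Geometry.Lorentzian.MetricCoord.sharpAt G x (fderiv ℝ (Literature.Geometry.Lorentzian.Kerr.radius a) x)))) ∧ (∀ x ∈ Literature.Geometry.Lorentzian.Kerr.region a r₀, Literature.Geometry.Lorentzian.MetricCoord.ricAt G x = 0) ∧ (∀ x ∈ Literature.Geometry.Lorentzian.Kerr.region a r₀, ∑ β : Fin 4, Literature.Geometry.Lorentzian.MetricCoord.chrAt G x (Literature.Geometry.Lorentzian.MetricCoord.sharpAt G x (Literature.Geometry.Lorentzian.E4.dx β)) (Literature.Geometry.Lorentzian.E4.basisVector β) = 0) ∧ (∀ k : ℕ, ∃ C : ℝ, ∀ x ∈ Literature.Geometry.Lorentzian.Kerr.region a r₀, ‖iteratedFDeriv ℝ k G x‖ ≤ C ∧ ‖Literature.Geometry.Lorentzian.MetricCoord.sharpAt G x‖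 ≤ C) ∧ (∃ C : ℝ, ∀ x ∈ Literature.Geometry.Lorentzian.Kerr.region a r₀, ‖G x - Literature.Geometry.Lorentzian.Minkowski.bilin‖ ≤ C / Literature.Geometry.Lorentzian.E4.spatialNorm x ∧ ‖iteratedFDeriv ℝ 1 G x‖ ≤ C / Literature.Geometry.Lorentzian.E4.spatialNorm x ^ 2 ∧ ‖iteratedFDeriv ℝ 2 G x‖ ≤ C / Literature.Geometry.Lorentzian.E4.spatialNorm x ^ 3)) → (∃ b C : ℝ, ∀ x ∈ Literature.Geometry.Lorentzian.Kerr.region a r₀, ∀ v w : Literature.Geometry.Lorentzian.E4, ∃ F : ℂ → ℂ, Differentiable ℂ F ∧ (∀ z : ℂ, ‖F z‖ ≤ C * ‖v‖ * ‖w‖ * Real.exp (b * |z.im|)) ∧ ∀ s : ℝ, F (s : ℂ) = ((G (x + s • Literature.Geometry.Lorentzian.E4.basisVector 0) v w : ℝ) : ℂ))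

/-- item stmt-FinalStateConjecture-10173 · crux · rank 4 · open · by planner
why it might fail: Kerr capture is now claimed for all |a|<M (Hintz arXiv:2606.28253, 2026, unrefereed), but X → FSC still contains weak cosmic censorship/complete 𝓘⁺ for generic LARGE data, C^k precompactness of late exteriors in comoving harmonic gauge (no theorem), smooth stationary ⇒ Kerr beyond near-Kerr.
sources: doi:10.1088/0264-9381/16/12a/302, arXiv:0805.3880, arXiv:2606.28253, arXiv:2606.28008, arXiv:2104.11857, arXiv:2205.14808
[crux] THE STATIONARY-LIMIT ARCHITECTURE: X → FinalStateConjecture. Informally: (i) for a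
Christodoulou-generic admissible datum the MGHD exists, has complete 𝓘⁺, and its exterior admits
late-time comoving harmonic charts with two-sided C^k bounds, so that every ω-limit
(time-translation limit) around each final concentration region is a G satisfying the hypotheses of
X (excised inside the apparent horizon, stationary-rate fall-off because Bondi mass and horizon area
are constant on ω-limits), or is empty (dispersal); (ii) by X the limit is stationary, hence (smooth
black-hole uniqueness in this class) a sub-extremal Kerr exterior, generically; (iii) uniqueness of
the limit plus Kerr capture (nonlinear stability) upgrades subsequential convergence to the C²
`FinalStateDecomposition` with `HasExhaustiveCharts`, receding holes pairwise separating. Shared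
with the LaSalle/dissipation-budget/Burnett cards; filed here so that the route decides the
Statement. [deps: EternalExteriorStationary] [difficulty: open-problem] -/
@[route_item "route-FinalStateConjecture-TemporalBandLiouville", crux]
def StationaryLimitReduction : Prop :=
  EternalExteriorStationary → _root_.FinalStateConjecture

/-- item stmt-FinalStateConjecture-18040 · crux · rank 5 · open · by planner
why it might fail: Smooth stationary ⇒ axisymmetric is open away from Kerr (IonescuKlainerman2012 non-extension; AIK only near Kerr): a non-Kerr stationary vacuum hole with ergoregion hair refutes it; harmonic spacelike slicing gives NO ergoregion analyticity (reduced operator elliptic iff ∂ₜ timelike).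
sources: IonescuKlainerman2012, AlexakisIonescuKlainerman2009, AlexakisIonescuKlainerman2014, ChruscielCosta2008, ChruscielCostaHeusler2012, arXiv:1002.1737
[crux] P2 of the typed decomposition of StationaryLimitReduction — STATIONARY HARMONIC EXTERIORS ARE
KERR = smooth no-hair in X's OWN presentation: for all a, r₀ > 0 and G in X's class (seven-clause
antecedent of EternalExteriorStationary verbatim) which is t-INDEPENDENT on the cylinder (X's
conclusion verbatim: G (x + s e₀) = G x), there are 0 < M′, |a′| ≤ M′ (extremal allowed) and a
smooth injective Ψ : Kerr.region a r₀ → {Kerr.radius a′ > 0} with G x (v,w) = Kerr.bilin M′ a′ (Ψ x)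
(DΨ_x v) (DΨ_x w): the whole cylinder, horizon collar included, is an isometrically embedded piece
of an ingoing Kerr–Schild Kerr spacetime (no time orientation or Killing normalisation is imposed;
Minkowski, negative-mass and super-extremal presentations are excluded by the inflow collar, which
forces ∂ₜ to be spacelike somewhere and a black-hole region to exist). Mathematical content:
black-hole uniqueness WITHOUT analyticity for ONE connected horizon — Hawking's stationary ⇒
axisymmetric needs analyticity or near-Kerr smallness (Alexakis–Ionescu–Klainerman
Carleman/T-pseudoconvexity), then Carter–Robinson–Mazur–Bunting–Weinstein + Chruściel–Costa
(non-degenerate) / Chruściel–Nguyen (degenerate). NB -/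
@[route_item "route-FinalStateConjecture-TemporalBandLiouville"]
def StationaryHarmonicExteriorIsKerr : Prop :=
  ∀ (a r₀ : ℝ) (G : Literature.Geometry.Lorentzian.E4 → Literature.Geometry.Lorentzian.E4 →L[ℝ] Literature.Geometry.Lorentzian.E4 →L[ℝ] ℝ), (0 < r₀ ∧ Literature.Geometry.Lorentzian.MetricCoord.IsMetricOn G (Literature.Geometry.Lorentzian.Kerr.region a r₀ : Set Literature.Geometry.Lorentzian.E4) ∧ (∃ c₀ δ : ℝ, 0 < c₀ ∧ 0 < δ ∧ ∀ x ∈ Literature.Geometry.Lorentzian.Kerr.region a r₀, (Literature.Geometry.Lorentzian.E4.dx 0) (Literature.Geometry.Lorentzian.MetricCoord.sharpAt G x (Literature.Geometry.Lorentzian.E4.dx 0)) ≤ -c₀ ∧ (Literature.Geometry.Lorentzian.Kerr.radius a x < r₀ + δ → (fderiv ℝ (Literature.Geometry.Lorentzian.Kerr.radius a) x) (Literature.Geometry.Lorentzian.MetricCoord.sharpAt G x (fderiv ℝ (Literature.Geometry.Lorentzian.Kerr.radius a) x)) ≤ -c₀ ∧ c₀ ≤ (Literature.Geometry.Lorentzian.E4.dx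 0) (Literature.Geometry.Lorentzian.MetricCoord.sharpAt G x (fderiv ℝ (Literature.Geometry.Lorentzian.Kerr.radius a) x)))) ∧ (∀ x ∈ Literature.Geometry.Lorentzian.Kerr.region a r₀, Literature.Geometry.Lorentzian.MetricCoord.ricAt G x = 0) ∧ (∀ x ∈ Literature.Geometry.Lorentzian.Kerr.region a r₀, ∑ β : Fin 4, Literature.Geometry.Lorentzian.MetricCoord.chrAt G x (Literature.Geometry.Lorentzian.MetricCoord.sharpAt G x (Literature.Geometry.Lorentzian.E4.dx β)) (Literature.Geometry.Lorentzian.E4.basisVector β) = 0) ∧ (∀ k : ℕ, ∃ C : ℝ, ∀ x ∈ Literature.Geometry.Lorentzian.Kerr.region a r₀, ‖iteratedFDeriv ℝ k G x‖ ≤ C ∧ ‖Literature.Geometry.Lorentzian.MetricCoord.sharpAt G x‖ ≤ C) ∧ (∃ C : ℝ, ∀ x ∈ Literature.Geometry.Lorentzian.Kerr.region a r₀, ‖G x - Literature.Geometry.Lorentzian.Minkowski.bilin‖ ≤ C / Literature.Geometry.Lorentzian.E4.spatialNorm x ∧ ‖iteratedFDeriv ℝ 1 G x‖ ≤ C / Literature.Geometry.Lorentzian.E4.spatialNorm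 x ^ 2 ∧ ‖iteratedFDeriv ℝ 2 G x‖ ≤ C / Literature.Geometry.Lorentzian.E4.spatialNorm x ^ 3)) → (∀ x ∈ Literature.Geometry.Lorentzian.Kerr.region a r₀, ∀ s : ℝ, G (x + s • Literature.Geometry.Lorentzian.E4.basisVector 0) = G x) → ∃ (M' a' : ℝ) (Ψ : Literature.Geometry.Lorentzian.E4 → Literature.Geometry.Lorentzian.E4), 0 < M' ∧ |a'| ≤ M' ∧ ContDiffOn ℝ (⊤ : ℕ∞) Ψ (Literature.Geometry.Lorentzian.Kerr.region a r₀ : Set Literature.Geometry.Lorentzian.E4) ∧ Set.InjOn Ψ (Literature.Geometry.Lorentzian.Kerr.region a r₀ : Set Literature.Geometry.Lorentzian.E4) ∧ (∀ x ∈ Literature.Geometry.Lorentzian.Kerr.region a r₀, 0 < Literature.Geometry.Lorentzian.Kerr.radius a' (Ψ x)) ∧ ∀ x ∈ Literature.Geometry.Lorentzian.Kerr.region a r₀, ∀ v w : Literature.Geometry.Lorentzian.E4, G x v w = Literature.Geometry.Lorentzian.Kerr.bilin M' a' (Ψ x) (fderiv ℝ Ψ x v) (fderiv ℝ Ψ x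 w)

/-- item stmt-FinalStateConjecture-18039 · crux · rank 6 · open · by planner
why it might fail: All-data strength: an eternal non-radiating vacuum geon (horizonless, outside X's excised class), C^k-non-compact late exteriors (Burnett weak limits exit vacuum, arXiv:1907.10743) or parameter drift defeat it even if every black-hole limit is Kerr; extremal end states strain C⁰ exhaustion.
sources: arXiv:1907.10743, KenigMerle2006, arXiv:1710.01722, arXiv:2104.08222, KehleUnger2025, Moschidis2016
[crux] P1 of the typed decomposition of StationaryLimitReduction (crux-strategist, route re-audit
RESTATED bin) — KERR EXTERIORS SETTLE = conditional POINTWISE C⁰ settling ('stability in the large'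
/ LaSalle in comoving harmonic gauge): IF every member of X's class (the seven-clause antecedent of
EternalExteriorStationary verbatim: a smooth symmetric invertible G on the excised cylinder
Kerr.region a r₀, slices uniformly spacelike, excision collar with dr timelike and inflow, Ric = 0,
harmonic gauge, all C^k norms of G and G⁻¹ bounded, stationary-rate fall-off to η) is an
ISOMETRICALLY EMBEDDED PIECE OF KERR (∃ 0 < M′, |a′| ≤ M′ — extremal allowed — and a smooth
injective Ψ on the cylinder into {Kerr.radius a′ > 0} with G x (v,w) = Kerr.bilin M′ a′ (Ψ x) (DΨ v)
(DΨ w), ingoing Kerr–Schild form), THEN every maximal vacuum Cauchy development of every admissible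
datum with complete 𝓘⁺ settles in C⁰ (the body of EternalPapapetrou.CompleteScriSettlesC0, item
17273, verbatim: O = exteriorOf, RaysStayInClosure, HasExhaustiveCharts with honest radii,
IsFutureOriented; |aᵢ| ≤ Mᵢ; N = 0 dispersal). Content the prover must supply: (i) precompactness of
late-time translates of the d.o.c. in co -/
@[route_item "route-FinalStateConjecture-TemporalBandLiouville"]
def KerrExteriorsSettle : Prop :=
  (∀ (a r₀ : ℝ) (G : Literature.Geometry.Lorentzian.E4 → Literature.Geometry.Lorentzian.E4 →L[ℝ] Literature.Geometry.Lorentzian.E4 →L[ℝ] ℝ), (0 < r₀ ∧ Literature.Geometry.Lorentzian.MetricCoord.IsMetricOn G (Literature.Geometry.Lorentzian.Kerr.region a r₀ : Set Literature.Geometry.Lorentzian.E4) ∧ (∃ c₀ δ : ℝ, 0 < c₀ ∧ 0 < δ ∧ ∀ x ∈ Literature.Geometry.Lorentzian.Kerr.region a r₀, (Literature.Geometry.Lorentzian.E4.dx 0) (Literature.Geometry.Lorentzian.MetricCoord.sharpAt G x (Literature.Geometry.Lorentzian.E4.dx 0)) ≤ -c₀ ∧ (Literature.Geometry.Lorentzian.Kerr.radius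 a x < r₀ + δ → (fderiv ℝ (Literature.Geometry.Lorentzian.Kerr.radius a) x) (Literature.Geometry.Lorentzian.MetricCoord.sharpAt G x (fderiv ℝ (Literature.Geometry.Lorentzian.Kerr.radius a) x)) ≤ -c₀ ∧ c₀ ≤ (Literature.Geometry.Lorentzian.E4.dx 0) (Literature.Geometry.Lorentzian.MetricCoord.sharpAt G x (fderiv ℝ (Literature.Geometry.Lorentzian.Kerr.radius a) x)))) ∧ (∀ x ∈ Literature.Geometry.Lorentzian.Kerr.region a r₀, Literature.Geometry.Lorentzian.MetricCoord.ricAt G x = 0) ∧ (∀ x ∈ Literature.Geometry.Lorentzian.Kerr.region a r₀, ∑ β : Fin 4, Literature.Geometry.Lorentzian.MetricCoord.chrAt G x (Literature.Geometry.Lorentzian.MetricCoord.sharpAt G x (Literature.Geometry.Lorentzian.E4.dx β)) (Literature.Geometry.Lorentzian.E4.basisVector β) = 0) ∧ (∀ k : ℕ, ∃ C : ℝ, ∀ x ∈ Literature.Geometry.Lorentzian.Kerr.region a r₀, ‖iteratedFDeriv ℝ k G x‖ ≤ C ∧ ‖Literature.Geometry.Lorentzian.MetricCoord.sharpAt G x‖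 ≤ C) ∧ (∃ C : ℝ, ∀ x ∈ Literature.Geometry.Lorentzian.Kerr.region a r₀, ‖G x - Literature.Geometry.Lorentzian.Minkowski.bilin‖ ≤ C / Literature.Geometry.Lorentzian.E4.spatialNorm x ∧ ‖iteratedFDeriv ℝ 1 G x‖ ≤ C / Literature.Geometry.Lorentzian.E4.spatialNorm x ^ 2 ∧ ‖iteratedFDeriv ℝ 2 G x‖ ≤ C / Literature.Geometry.Lorentzian.E4.spatialNorm x ^ 3)) → ∃ (M' a' : ℝ) (Ψ : Literature.Geometry.Lorentzian.E4 → Literature.Geometry.Lorentzian.E4), 0 < M' ∧ |a'| ≤ M' ∧ ContDiffOn ℝ (⊤ : ℕ∞) Ψ (Literature.Geometry.Lorentzian.Kerr.region a r₀ : Set Literature.Geometry.Lorentzian.E4) ∧ Set.InjOn Ψ (Literature.Geometry.Lorentzian.Kerr.region a r₀ : Set Literature.Geometry.Lorentzian.E4) ∧ (∀ x ∈ Literature.Geometry.Lorentzian.Kerr.region a r₀, 0 < Literature.Geometry.Lorentzian.Kerr.radius a' (Ψ x)) ∧ ∀ x ∈ Literature.Geometry.Lorentzian.Kerr.region a r₀,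 ∀ v w : Literature.Geometry.Lorentzian.E4, G x v w = Literature.Geometry.Lorentzian.Kerr.bilin M' a' (Ψ x) (fderiv ℝ Ψ x v) (fderiv ℝ Ψ x w)) → ∀ (X : Type) [TopologicalSpace X] [ChartedSpace Literature.Geometry.Lorentzian.E3 X] [IsManifold (𝓡 3) (⊤ : ℕ∞) X] [T2Space X] [SecondCountableTopology X] [ConnectedSpace X], ∀ D ∈ Literature.Geometry.Lorentzian.admissibleVacuumData X, ∀ 𝒟 : Literature.Geometry.Lorentzian.VacuumCauchyDevelopment D, 𝒟.IsMaximal → Summit.FinalStateConjecture.HasCompleteNullInfinity 𝒟.toCauchyDevelopment → ∃ (O : Set 𝒟.carrier) (d : Literature.Geometry.Lorentzian.FinalStateDecomposition 𝒟.toSpacetime O 0), O = Summit.FinalStateConjecture.exteriorOf 𝒟.toCauchyDevelopment d.charted ∧ Summit.FinalStateConjecture.RaysStayInClosure 𝒟.toCauchyDevelopment O ∧ Summit.FinalStateConjecture.HasExhaustiveCharts d ∧ Summit.FinalStateConjecture.IsFutureOriented d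

/-- item stmt-FinalStateConjecture-17308 · crux · rank 7 · open · by planner
why it might fail: Contains weak cosmic censorship in TAME form (open): escape families must live on the datum's own end with continuous mass; plus codim-1 of threshold collapse to extremal holes (KehleUnger2025) and the C⁰⇒C² sub-extremal upgrade (full |a|<M capture only claimed 2026, arXiv:2606.28253).
sources: Christodoulou1999, arXiv:1710.01722, KehleUnger2025, AngelopoulosKehleUnger2024, arXiv:2205.14808, arXiv:2606.28253
[crux] G (repaired 2026-08-16 after the Statement re-type T2, p126844: TAME genericity on one fixed
end; MGHD existence folded in so that `closes` is crux-only) = the imported generic side of the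
Statement, stated ONCE because curve-genericity is not closed under conjunction (card
genericity-is-not-closed-under-and): for every X, the property "the datum has a maximal
VacuumCauchyDevelopment (Choquet-Bruhat–Geroch; for ALL admissible data this is the support item
MGHDExists), every maximal VacuumCauchyDevelopment has complete future null infinity, AND every C⁰
exhaustive, future-oriented final-state decomposition d₀ of its self-determined exterior O =
exteriorOf d₀.charted with RaysStayInClosure O can be upgraded to a C² exhaustive, future-oriented
decomposition d, O' = exteriorOf d.charted, RaysStayInClosure O', all of whose holes are
sub-extremal |aᵢ| < Mᵢ" is TAME-Christodoulou-generic with codimension 1 in admissibleVacuumData X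
(InitialDataSet.IsTameChristodoulouGeneric … 1: through every exceptional datum passes an injective
one-parameter family of admissible data living on ONE fixed asymptotically flat end with
Dafermos–Rodnianski rates and continuous mass, jointly smooth, wD -/
@[route_item "route-FinalStateConjecture-TemporalBandLiouville"]
def GenericCensoredCapture : Prop :=
  ∀ (X : Type) [TopologicalSpace X] [ChartedSpace Literature.Geometry.Lorentzian.E3 X] [IsManifold (𝓡 3) (⊤ : ℕ∞) X] [T2Space X] [SecondCountableTopology X] [ConnectedSpace X], Literature.Geometry.Lorentzian.InitialDataSet.IsTameChristodoulouGeneric (Literature.Geometry.Lorentzian.admissibleVacuumData X) (fun D ↦ (∃ 𝒟 : Literature.Geometry.Lorentzian.VacuumCauchyDevelopment D, 𝒟.IsMaximal) ∧ ∀ 𝒟 : Literature.Geometry.Lorentzian.VacuumCauchyDevelopment D, 𝒟.IsMaximal → Summit.FinalStateConjecture.HasCompleteNullInfinity 𝒟.toCauchyDevelopment ∧ ∀ (O : Set 𝒟.carrier) (d₀ : Literature.Geometry.Lorentzian.FinalStateDecomposition 𝒟.toSpacetime O 0), O = Summit.FinalStateConjecture.exteriorOf 𝒟.toCauchyDevelopment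 d₀.charted → Summit.FinalStateConjecture.RaysStayInClosure 𝒟.toCauchyDevelopment O → Summit.FinalStateConjecture.HasExhaustiveCharts d₀ → Summit.FinalStateConjecture.IsFutureOriented d₀ → ∃ (O' : Set 𝒟.carrier) (d : Literature.Geometry.Lorentzian.FinalStateDecomposition 𝒟.toSpacetime O' 2), (∀ i, Literature.Geometry.Lorentzian.Kerr.IsSubextremal (d.mass i) (d.spin i)) ∧ O' = Summit.FinalStateConjecture.exteriorOf 𝒟.toCauchyDevelopment d.charted ∧ Summit.FinalStateConjecture.RaysStayInClosure 𝒟.toCauchyDevelopment O' ∧ Summit.FinalStateConjecture.HasExhaustiveCharts d ∧ Summit.FinalStateConjecture.IsFutureOriented d) 1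

/-- item stmt-FinalStateConjecture-10174 · support · rank 9 · open · by planner
sources: arXiv:1810.09047
[support] BandFromNonradiation → BandLimitedLiouville → EternalExteriorStationary (pure logic; the
hypothesis bundles are syntactically identical; proved in Sketch.lean `targetOfCruxes_holds`).
[difficulty: provable-now] -/
@[route_item "route-FinalStateConjecture-TemporalBandLiouville", crux]
def TargetOfCruxes : Prop :=
  BandFromNonradiation → BandLimitedLiouville → EternalExteriorStationary

/-- item stmt-FinalStateConjecture-10175 · support · rank 9 · open · by planner
sources: doi:10.1080/03605309508821117, doi:10.4171/jems/854, doi:10.4310/jdg/1513998029, doi:10.1088/0264-9381/27/5/055007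
[support] THE KNOWN-TECHNOLOGY HALF OF C2 (Rellich zone + time-analytic continuation, belt
excluded): under the hypotheses of X, if G is merely time-ANALYTIC IN A UNIFORM STRIP (each
component extends holomorphically to {|Im z| < σ}, bounded by C‖v‖‖w‖) and on the far zone {ρ ≥ r₁}
the field ∂_t is uniformly timelike (G(e₀,e₀) ≤ −c₁) and the coordinate spheres are uniformly
non-characteristic (g⁻¹(dρ,dρ) ≥ c₁), then G is t-independent on {ρ > r₁}. Proof plan: h = ∂_tG
solves the linearised reduced system; Fourier in t + Rellich–Vekua for the weakly coupled Helmholtz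
system with Coulomb tails kills h near infinity; Tataru–Robbiano–Zuily–Hörmander (transversally
elliptic case (E)) sweeps the spheres inward, uniformly in t by the C^k bounds. Serves
eternal-papapetrou-temporal-spectrum as well (its conditional K3(ii)). [difficulty: L] -/
@[route_item "route-FinalStateConjecture-TemporalBandLiouville", crux]
def StaticZoneLiouville : Prop :=
  ∀ (a r₀ r₁ : ℝ) (G : Literature.Geometry.Lorentzian.E4 → Literature.Geometry.Lorentzian.E4 →L[ℝ] Literature.Geometry.Lorentzian.E4 →L[ℝ] ℝ), (0 < r₀ ∧ Literature.Geometry.Lorentzian.MetricCoord.IsMetricOn G (Literature.Geometry.Lorentzian.Kerr.region a r₀ : Set Literature.Geometry.Lorentzian.E4) ∧ (∃ c₀ δ : ℝ, 0 < c₀ ∧ 0 < δ ∧ ∀ x ∈ Literature.Geometry.Lorentzian.Kerr.region a r₀, (Literature.Geometry.Lorentzian.E4.dx 0) (Literature.Geometry.Lorentzian.MetricCoord.sharpAt G x (Literature.Geometry.Lorentzian.E4.dx 0)) ≤ -c₀ ∧ (Literature.Geometry.Lorentzian.Kerr.radius a x < r₀ + δ → (fderiv ℝ (Literature.Geometry.Lorentzian.Kerr.radius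 a) x) (Literature.Geometry.Lorentzian.MetricCoord.sharpAt G x (fderiv ℝ (Literature.Geometry.Lorentzian.Kerr.radius a) x)) ≤ -c₀ ∧ c₀ ≤ (Literature.Geometry.Lorentzian.E4.dx 0) (Literature.Geometry.Lorentzian.MetricCoord.sharpAt G x (fderiv ℝ (Literature.Geometry.Lorentzian.Kerr.radius a) x)))) ∧ (∀ x ∈ Literature.Geometry.Lorentzian.Kerr.region a r₀, Literature.Geometry.Lorentzian.MetricCoord.ricAt G x = 0) ∧ (∀ x ∈ Literature.Geometry.Lorentzian.Kerr.region a r₀, ∑ β : Fin 4, Literature.Geometry.Lorentzian.MetricCoord.chrAt G x (Literature.Geometry.Lorentzian.MetricCoord.sharpAt G x (Literature.Geometry.Lorentzian.E4.dx β)) (Literature.Geometry.Lorentzian.E4.basisVector β) = 0) ∧ (∀ k : ℕ, ∃ C : ℝ, ∀ x ∈ Literature.Geometry.Lorentzian.Kerr.region a r₀, ‖iteratedFDeriv ℝ k G x‖ ≤ C ∧ ‖Literature.Geometry.Lorentzian.MetricCoord.sharpAt G x‖ ≤ C) ∧ (∃ C : ℝ, ∀ x ∈ Literature.Geometry.Lorentzian.Kerr.region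 a r₀, ‖G x - Literature.Geometry.Lorentzian.Minkowski.bilin‖ ≤ C / Literature.Geometry.Lorentzian.E4.spatialNorm x ∧ ‖iteratedFDeriv ℝ 1 G x‖ ≤ C / Literature.Geometry.Lorentzian.E4.spatialNorm x ^ 2 ∧ ‖iteratedFDeriv ℝ 2 G x‖ ≤ C / Literature.Geometry.Lorentzian.E4.spatialNorm x ^ 3)) → (∃ σ C : ℝ, 0 < σ ∧ ∀ x ∈ Literature.Geometry.Lorentzian.Kerr.region a r₀, ∀ v w : Literature.Geometry.Lorentzian.E4, ∃ F : ℂ → ℂ, DifferentiableOn ℂ F {z : ℂ | |z.im| < σ} ∧ (∀ z : ℂ, |z.im| < σ → ‖F z‖ ≤ C * ‖v‖ * ‖w‖) ∧ ∀ s : ℝ, F (s : ℂ) = ((G (x + s • Literature.Geometry.Lorentzian.E4.basisVector 0) v w : ℝ) : ℂ)) → (∃ c₁ : ℝ, 0 < c₁ ∧ ∀ x ∈ Literature.Geometry.Lorentzian.Kerr.region a r₀, r₁ ≤ Literature.Geometry.Lorentzian.E4.spatialNorm x → G x (Literature.Geometry.Lorentzian.E4.basisVector 0) (Literature.Geometry.Lorentzian.E4.basisVector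 0) ≤ -c₁ ∧ c₁ ≤ (fderiv ℝ Literature.Geometry.Lorentzian.E4.spatialNorm x) (Literature.Geometry.Lorentzian.MetricCoord.sharpAt G x (fderiv ℝ Literature.Geometry.Lorentzian.E4.spatialNorm x))) → ∀ x ∈ Literature.Geometry.Lorentzian.Kerr.region a r₀, r₁ < Literature.Geometry.Lorentzian.E4.spatialNorm x → ∀ s : ℝ, G (x + s • Literature.Geometry.Lorentzian.E4.basisVector 0) = G x

/-- item stmt-FinalStateConjecture-18041 · support · rank 9 · open · by planner
sources: arXiv:1710.01722, Christodoulou1999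
[support] GLUE OF THE LAYER-2 SPLIT (BC2 redirect) OF StationaryLimitReduction (strategist
cstrat-10173; provable now — candidate proof attached as evidence: Glue.lean by name, and the
Theses-free frame TemporalBandLiouvilleStationaryLimitReductionSplit.lean with all four bodies
inlined, both lean check rc0, sorries 0, axioms propext·Classical.choice·Quot.sound):
KerrExteriorsSettle → StationaryHarmonicExteriorIsKerr → GenericCensoredCapture →
StationaryLimitReduction. Proof (pure logic): given hX : EternalExteriorStationary every member of
X's class is t-independent (hX) hence an embedded Kerr piece (P2), so P1 yields the pointwise C⁰
settling theorem T (= the body of EternalPapapetrou.CompleteScriSettlesC0); tame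
Christodoulou-genericity of codimension 1 is monotone in the property and, pointwise on admissible
data, P3 upgrades T's C⁰ decomposition to the Statement's sub-extremal C² one, threading
RaysStayInClosure / HasExhaustiveCharts / IsFutureOriented (the certified EternalPapapetrou seam,
cf. Theorems.EternalPapapetrou.assembly_proof). With it StationaryLimitReduction is DERIVED from the
three pieces; the formal `route edit --split StationaryLimitReduction --glue-by <this th -/
@[route_item "route-FinalStateConjecture-TemporalBandLiouville"]
def StationaryLimitReductionOfSplit : Prop :=
  KerrExteriorsSettle → StationaryHarmonicExteriorIsKerr → GenericCensoredCapture → StationaryLimitReduction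

/-- item stmt-FinalStateConjecture-10176 · assembly · rank 1 · open · by planner
sources: arXiv:1710.01722, arXiv:1810.09047
[assembly] BandFromNonradiation → BandLimitedLiouville → StationaryLimitReduction →
FinalStateConjecture. -/
@[route_item "route-FinalStateConjecture-TemporalBandLiouville", crux]
def Assembly : Prop :=
  BandFromNonradiation → BandLimitedLiouville → StationaryLimitReduction → _root_.FinalStateConjecture

/-! D-0027 §2.1 — DECIDING THEOREM (planner-authored via `route open/edit --closes-file`; by planner-plancard-FinalStateConjecture-FinalSt-3fc921ed-0 2026-08-15T15:16:26Z):
its hypotheses are this route's items and its conclusion the sub-problem Statement (glue_lint), and it elaborates with this file. -/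

@[closes "route-FinalStateConjecture-TemporalBandLiouville"] theorem closes (hX : EternalExteriorStationary) (_hL : BandLimitedLiouville) (_hB : BandFromNonradiation)
    (hR : StationaryLimitReduction) (_hT : TargetOfCruxes) (_hZ : StaticZoneLiouville) (_hA : Assembly) :
    _root_.FinalStateConjecture :=
  hR hX

end Summit.FinalStateConjecture.FinalStateConjecture.Theses.TemporalBandLiouville
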